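import Literature.NumberTheory.Automorphic.Liu2021.Thm418ProofMapRational
import Literature.NumberTheory.Automorphic.Liu2021.Thm418CombinedOfRationalPullback
import HarnessLib

/-!
# [Liu 2021, Thm. 4.18] AS PRINTED ⟹ the combined reading r8 at one `μ` — OVER THE RECORDS (the proof map (4.3) read on its
# rational carriers `Map43RationalData`; no `J`/`hJ`/`hJinj` binder left)

Y. Liu, *Fourier–Jacobi cycles and arithmetic relative trace formula*, Camb. J. Math. **9** (2021) 1–147 = arXiv:2102.11518
[Liu2021]; TeX source `FJcycle.tex` (md5 `6db49a74122d2cb0f224fa1b39488a0c`; `l. NNNN` = its lines).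

## What this file is

The END of the Literature-side Δ2 chain (pub-hodgecm2 HM-EQUALITY Δ2, «cite [Liu 4.18] AS PRINTED instead of the combined reading
r8»).  The r8 shape at one `μ` — «below some level `K₀`, every `Kof K`-fixed vector of the `μ`-block of `H = H¹_{B,τ'}(A_∞, ℂ)`
restricts into the span of the CM classes» — is derived here from:

* `h : Thm418AsPrinted D` — [Liu2021] Thm. 4.18 EXACTLY AS PRINTED (`Thm418AsPrinted.lean`, p277833);
* `M : D.Map43RationalData` — the objects of the PROOF of Thm. 4.18 (l. 2247–2266) on their RATIONAL carriers
  (`Thm418ProofMapRational.lean`, item6-p1): `D_μ`, `τ'`, `H¹_{B,τ'}(A_∞, ℚ)` with its Hecke action and the comparison `ι` into the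
  complex carrier `M.HB = H¹_{B,τ'}(A_∞, ℂ)`, `H¹_{B,τ'}(A_μ, ℚ)` as an `M_μ`-line (l. 650 + Def. 4.5 (2)), Liu's chosen `α` (l. 2250),
  and `f ↦ f^*` with its laws; over these, the printed assertions (i) «the eigenline is a line», (ii) «`ℂ[𝔾(𝔸_F^∞)]`-linear»,
  (iii) «(4.3) is injective» are THEOREMS (`Map43RationalData.map43AsPrinted`, using `Map43Injective.lean` for (iii));
* `hnv` — every `ω(μ,ε,χ)` is non-zero (Def. 4.11 / App. D Lem. D.1 (1); tree `LemD1AsPrinted`, `Def411AsPrinted`);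
* `hmult` — multiplicity one ([Liu2021] proof of Prop. 4.13, l. 2145; record `Prop413MultOneAsPrinted`);
* the consumer's readings, which are DEFINITIONS at an honest instantiation: the `ℂ[𝔾(𝔸_F^∞)]`-module structure on `M.HB` agreeing
  with `M.ρB` (`hof`), the level family `Kof` («sufficiently small», §4.2 l. 2060), the geometric side `resW`/`cmCl`, and the class
  identification `hpin` (Lem. 2.4 (1) l. 1210–1213: the level-`K` restriction of `φ^*α` is one of the consumer's CM classes).

It is the composition of this lineage's `Thm418Data.iSup_range_resW_mem_span_of_thm418AsPrinted_of_eigenPullback`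
(`Thm418CombinedOfRationalPullback.lean` §1) with the record's fields and theorems; and, for LIU'S OWN classes `(φ^*α)|_K` (§3 there),
the same with NO class-identification binder `hpin` (`Map43RationalData.iSup_range_resW_mem_span_liuClasses_of_thm418AsPrinted`,
`…_of_liuClasses_subset` for a consumer class set containing them).  No theorem carries a finiteness binder:
`Module.Finite ℚ H¹_{B,τ'}(A_μ, ℚ)` is DERIVED (`Map43RationalData.finite_rat_L`: an `M_μ`-line over the number field `M_μ`,
tree `Thm418Data.numberField_fieldOfValues`).  Theorems only; no definition, no named fact;
nothing about Liu's objects is constructed.  HC_CM is NOT proved; this file discharges no binder of the COR-CM chain by itself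
(the consumer — item6-p2's placement junction / the pinning record — instantiates `M` with the honest tower and reads `hpin`,
`resW`, `cmCl` on it).  Seats prover-pub-hodgecm2-tr-prover-6-g4-0 / -g5-0 / -g7-0 (item-(vi) END-display lineage, X1 owner with
item6-p1), 2026-08-21/22.

## References
* [Liu2021] Thm. 4.18 (l. 2232–2245) with proof and map (4.3) (l. 2247–2266); Prop. 4.13 with proof l. 2145; Lem. 2.4 (1)
  (l. 1210–1213); Def. 4.5 (2); Def. 4.11; §4.2 l. 2060–2081; l. 650.
* Tree: `Liu2021.Thm418ProofMapRational` + `Thm418ProofMapAsPrinted` + `Thm418ValueField` (item6-p1), `Liu2021.Map43Injective` +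
  `Thm418CombinedOfRationalPullback` + `Map43CanonicalExtension` + `Thm418BlockLeRange` (this lineage), `Liu2021.Thm418CombinedReading` (pin-3).
-/

noncomputable section

open scoped TensorProduct
open TensorProduct Module NumberField

namespace Literature.NumberTheory.Automorphic.Liu2021

namespace Thm418Data

namespace Map43RationalData

variable {F E : Type} [Field F] [NumberField F] [IsTotallyReal F] [Field E] [NumberField E] [Algebra F E]
  [IsTotallyComplex E] [Algebra.IsQuadraticExtension F E] {D : Thm418Data F E} (M : D.Map43RationalData)

/-- **`H¹_{B,τ'}(A_μ, ℚ)` is finite-dimensional over `ℚ`** — no hypothesis: it is an `M_μ`-line (the record's law `rank_L`,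
«`A_μ` has dimension `[M_μ:ℚ]/2`», l. 650, with the CM structure `i_μ` of Def. 4.5 (2)) and `M_μ` is a number field (l. 1928; tree
THEOREM `Thm418Data.numberField_fieldOfValues`, `Thm418ValueField.lean`).  This is why no theorem of this file carries a
`[Module.Finite ℚ M.L]` binder (the finiteness the tree's `Map43Injective` / `Thm418CombinedOfRationalPullback` theorems take as an
instance is DERIVED here, cf. the referee of p309893 on derivable instance binders).  HC_CM is NOT proved.
[cite: Liu2021, §4.1 l. 650 and l. 1928; Def. 4.5 (2)] -/
theorem finite_rat_L : Module.Finite ℚ M.L := by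
  haveI : NumberField (fieldOfValues E D.μ) := D.numberField_fieldOfValues
  haveI : Module.Finite (fieldOfValues E D.μ) M.L := Module.finite_of_finrank_eq_succ M.rank_L
  exact Module.Finite.trans (fieldOfValues E D.μ) M.L

/-- **Equivariance of (4.3) in `ℂ[G]`-module currency, over the rational record.**  For any `ℂ[𝔾(𝔸_F^∞)]`-module structure on
`M.HB = H¹_{B,τ'}(A_∞, ℂ)` agreeing with the record's action `M.ρB` (`hof`), the proof map (4.3) satisfies
`J ((g ⊗ 1) x) = of g • J x` — clause (ii) «by pulling back `α`, which is `ℂ[𝔾(𝔸_F^∞)]`-linear» (l. 2250; (4.3) = l. 2251–2253, read on pure tensors as `z ⊗ f ↦ z·f^*α`), a THEOREM over the rational carriers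
(`Map43RationalData.pb_rhoΩ` / `Map43Data.hJ_of_asPrinted`).  The `show M.HB from …` only reminds the
elaborator that `M.toMap43Data.HB` is `M.HB` (so that the consumer's `ℂ[G]`-instance on `M.HB` applies).  HC_CM is NOT proved.
[cite: Liu2021, proof of Thm. 4.18 (FJcycle.tex l. 2250)] -/
theorem hJ_of [Module (MonoidAlgebra ℂ D.G) M.HB]
    (hof : ∀ (g : D.G) (x : M.HB), MonoidAlgebra.of ℂ D.G g • x = M.ρB g x)
    (g : D.G) (x : ℂ ⊗[fieldOfValues E D.μ] D.Ω) :
    M.toMap43Data.J ((D.rhoΩ g).baseChange ℂ x) =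
      MonoidAlgebra.of ℂ D.G g • (show M.HB from M.toMap43Data.J x) := by
  haveI := M.finite_rat_L
  rw [hof]
  exact Map43Data.hJ_of_asPrinted M.map43AsPrinted g x

/-- **[Liu2021, Thm. 4.18] AS PRINTED ⟹ the combined reading r8 at one `μ`, OVER THE RECORDS (rank-one branch).**  From
`h : Thm418AsPrinted D` (the statement exactly as printed), the rational record `M : D.Map43RationalData` of the proof's objects
(on which (i)(ii)(iii) of the proof are theorems), `hnv` (Def. 4.11 / Lem. D.1 (1)) and `hmult` (proof of Prop. 4.13, l. 2145), for
the consumer's readings `hof` (the `ℂ[G]`-structure on `H¹_{B,τ'}(A_∞, ℂ)` is `M.ρB`), `Kof` (level family), `resW`/`cmCl` (geometric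
side) and `hpin` (class identification, Lem. 2.4 (1)): below some level `K₀`, every `Kof K`-fixed vector of the intrinsic `μ`-block
`⨆_{(ε,χ)} ⨆_{ψ : ω(μ,ε,χ) →ₗ[ℂ[G]] H} range ψ` of `H = M.HB` restricts into `span ℂ (cmCl K)` — the package's `Thm418Combined res cmCl`
at this `μ`.  NO `Φ`, NO `hblock`, NO `J`/`hJ`/`hJinj` binder: the proof map (4.3) is the record's `M.toMap43Data.J`.
HC_CM is NOT proved; no pin is discharged here.
[cite: Liu2021, Thm. 4.18 (l. 2232–2245) with proof map (4.3) (l. 2247–2266); Prop. 4.13, proof l. 2145; Lem. 2.4 (1) (l. 1210–1213); Def. 4.11] -/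
theorem iSup_range_resW_mem_span_of_thm418AsPrinted
    [Module (MonoidAlgebra ℂ D.G) M.HB] [IsScalarTower ℂ (MonoidAlgebra ℂ D.G) M.HB]
    (hof : ∀ (g : D.G) (x : M.HB), MonoidAlgebra.of ℂ D.G g • x = M.ρB g x)
    (h : Liu2021.Thm418AsPrinted D)
    {Lvl : Type*} [Preorder Lvl] (Kof : Lvl → Subgroup D.G)
    (hmono : ∀ ⦃K K' : Lvl⦄, K ≤ K' → Kof K ≤ Kof K') (hoc : ∀ K : Lvl, IsOpenCompact (Kof K))
    (hcof : ∀ K' : Subgroup D.G, IsOpenCompact K' → ∃ K₀ : Lvl, Kof K₀ ≤ K')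
    {W : Lvl → Type*} [∀ K, AddCommGroup (W K)] [∀ K, Module ℂ (W K)]
    (resW : ∀ K : Lvl, M.HB →ₗ[ℂ] W K) (cmCl : ∀ K : Lvl, Set (W K))
    (hpin : ∀ (K : Lvl) (φ : D.HomK (Kof K) M.Dμ),
      resW K (M.toMap43Data.J ((1 : ℂ) ⊗ₜ[fieldOfValues E D.μ] D.res (Kof K) M.Dμ φ)) ∈ cmCl K)
    (hnv : ∀ i : D.AdmIndex, Nontrivial (D.omegaAt i))
    (hmult : ∀ i : D.AdmIndex, Module.rank ℂ ((D.rhoAt i).asModule →ₗ[MonoidAlgebra ℂ D.G] M.HB) ≤ 1) :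
    ∃ K₀ : Lvl, ∀ K ≤ K₀,
      ∀ x ∈ (⨆ i : D.AdmIndex, ⨆ ψ : (D.rhoAt i).asModule →ₗ[MonoidAlgebra ℂ D.G] M.HB, (LinearMap.range ψ).restrictScalars ℂ),
        (∀ k ∈ Kof K, MonoidAlgebra.of ℂ D.G k • x = x) → resW K x ∈ Submodule.span ℂ (cmCl K) := by
  haveI := M.finite_rat_L
  exact iSup_range_resW_mem_span_of_thm418AsPrinted_of_eigenPullback h M.Dμ Kof hmono hoc hcof resW cmCl M.rank_L M.P
    M.P_smul_apply M.P_injective M.α M.α_ne M.α_mem M.ι M.ι_injective M.toMap43Data.J M.J_tmul (M.hJ_of hof) hpin hnv hmult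

/-- **The same with multiplicity one in the record's currency** (bundled intertwining maps into `ofModule' M.HB`, LITERALLY
`Prop413Data.MultOneAsPrinted.rank_intertwiningMap_le_one` at the consumer's pin).  HC_CM is NOT proved.
[cite: Liu2021, Thm. 4.18 (l. 2232–2245) with proof map (4.3) (l. 2247–2266); Prop. 4.13, proof l. 2145; Lem. 2.4 (1) (l. 1210–1213); Def. 4.11] -/
theorem iSup_range_resW_mem_span_of_thm418AsPrinted_of_rank_intertwiningMap_le_one
    [Module (MonoidAlgebra ℂ D.G) M.HB] [IsScalarTower ℂ (MonoidAlgebra ℂ D.G) M.HB]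
    (hof : ∀ (g : D.G) (x : M.HB), MonoidAlgebra.of ℂ D.G g • x = M.ρB g x)
    (h : Liu2021.Thm418AsPrinted D)
    {Lvl : Type*} [Preorder Lvl] (Kof : Lvl → Subgroup D.G)
    (hmono : ∀ ⦃K K' : Lvl⦄, K ≤ K' → Kof K ≤ Kof K') (hoc : ∀ K : Lvl, IsOpenCompact (Kof K))
    (hcof : ∀ K' : Subgroup D.G, IsOpenCompact K' → ∃ K₀ : Lvl, Kof K₀ ≤ K')
    {W : Lvl → Type*} [∀ K, AddCommGroup (W K)] [∀ K, Module ℂ (W K)]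
    (resW : ∀ K : Lvl, M.HB →ₗ[ℂ] W K) (cmCl : ∀ K : Lvl, Set (W K))
    (hpin : ∀ (K : Lvl) (φ : D.HomK (Kof K) M.Dμ),
      resW K (M.toMap43Data.J ((1 : ℂ) ⊗ₜ[fieldOfValues E D.μ] D.res (Kof K) M.Dμ φ)) ∈ cmCl K)
    (hnv : ∀ i : D.AdmIndex, Nontrivial (D.omegaAt i))
    (hmult : ∀ i : D.AdmIndex,
      Module.rank ℂ (Representation.IntertwiningMap (D.rhoAt i) (Representation.ofModule' (k := ℂ) M.HB)) ≤ 1) :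
    ∃ K₀ : Lvl, ∀ K ≤ K₀,
      ∀ x ∈ (⨆ i : D.AdmIndex, ⨆ ψ : (D.rhoAt i).asModule →ₗ[MonoidAlgebra ℂ D.G] M.HB, (LinearMap.range ψ).restrictScalars ℂ),
        (∀ k ∈ Kof K, MonoidAlgebra.of ℂ D.G k • x = x) → resW K x ∈ Submodule.span ℂ (cmCl K) := by
  haveI := M.finite_rat_L
  exact iSup_range_resW_mem_span_of_thm418AsPrinted_of_eigenPullback_of_rank_intertwiningMap_le_one h M.Dμ Kof hmono hoc hcof
    resW cmCl M.rank_L M.P M.P_smul_apply M.P_injective M.α M.α_ne M.α_mem M.ι M.ι_injective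
    M.toMap43Data.J M.J_tmul (M.hJ_of hof) hpin hnv hmult

/-- **r8 at one `μ` for LIU'S OWN CM classes `(φ^*α)|_K`, OVER THE RECORDS — NO `Φ`, `hblock`, `J`, `hJ`, `hJinj`, `hpin` binder.**
From `h : Thm418AsPrinted D` (the statement exactly as printed), the rational record `M : D.Map43RationalData` of the proof's objects
(its laws `P_comm` / `ι_comm` give «`ℂ[𝔾(𝔸_F^∞)]`-linear», l. 2250, and `Map43Injective` gives «injective», l. 2252–2266, as
theorems), `hnv` (Def. 4.11 / Lem. D.1 (1)) and `hmult` (proof of Prop. 4.13, l. 2145), for the consumer's readings `hof` (the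
`ℂ[G]`-structure on `M.HB = H¹_{B,τ'}(A_∞, ℂ)` is `M.ρB`), `Kof` (level family) and `resW` (geometric side): below some level `K₀`, every
`Kof K`-fixed vector of the intrinsic `μ`-block of `M.HB` restricts, under `resW K`, into the `ℂ`-span of Liu's classes
`resW K (M.ι ((φ^*)_ℂ α))`, `φ ∈ Hom_E(A_K, A_μ)_ℚ` (`= (φ^*α)|_{X_K}` by Lem. 2.4 (1), l. 1210–1213).  Composition of this lineage's
`Thm418Data.iSup_range_resW_mem_span_liuClasses_of_thm418AsPrinted` (`Thm418CombinedOfRationalPullback.lean` §3) with the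
record's fields.  HC_CM is NOT proved; no pin is discharged here.
[cite: Liu2021, Thm. 4.18 (l. 2232–2245) with proof map (4.3) (l. 2247–2266); Prop. 4.13, proof l. 2145; Lem. 2.4 (1) (l. 1210–1213); Def. 4.11] -/
theorem iSup_range_resW_mem_span_liuClasses_of_thm418AsPrinted
    [Module (MonoidAlgebra ℂ D.G) M.HB] [IsScalarTower ℂ (MonoidAlgebra ℂ D.G) M.HB]
    (hof : ∀ (g : D.G) (x : M.HB), MonoidAlgebra.of ℂ D.G g • x = M.ρB g x)
    (h : Liu2021.Thm418AsPrinted D)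
    {Lvl : Type*} [Preorder Lvl] (Kof : Lvl → Subgroup D.G)
    (hmono : ∀ ⦃K K' : Lvl⦄, K ≤ K' → Kof K ≤ Kof K') (hoc : ∀ K : Lvl, IsOpenCompact (Kof K))
    (hcof : ∀ K' : Subgroup D.G, IsOpenCompact K' → ∃ K₀ : Lvl, Kof K₀ ≤ K')
    {W : Lvl → Type*} [∀ K, AddCommGroup (W K)] [∀ K, Module ℂ (W K)]
    (resW : ∀ K : Lvl, M.HB →ₗ[ℂ] W K)
    (hnv : ∀ i : D.AdmIndex, Nontrivial (D.omegaAt i))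
    (hmult : ∀ i : D.AdmIndex, Module.rank ℂ ((D.rhoAt i).asModule →ₗ[MonoidAlgebra ℂ D.G] M.HB) ≤ 1) :
    ∃ K₀ : Lvl, ∀ K ≤ K₀,
      ∀ x ∈ (⨆ i : D.AdmIndex, ⨆ ψ : (D.rhoAt i).asModule →ₗ[MonoidAlgebra ℂ D.G] M.HB, (LinearMap.range ψ).restrictScalars ℂ),
        (∀ k ∈ Kof K, MonoidAlgebra.of ℂ D.G k • x = x) →
          resW K x ∈ Submodule.span ℂ
            (Set.range fun φ : D.HomK (Kof K) M.Dμ => resW K (M.ι ((M.P (D.res (Kof K) M.Dμ φ)).baseChange ℂ M.α))) := by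
  haveI := M.finite_rat_L
  exact Thm418Data.iSup_range_resW_mem_span_liuClasses_of_thm418AsPrinted h M.Dμ Kof hmono hoc hcof resW M.rank_L M.P
    M.P_smul_apply M.P_injective M.ρU M.P_comm M.α M.α_ne M.α_mem M.ι M.ι_injective (fun g u => by rw [M.ι_comm, hof])
    M.toMap43Data.J M.J_tmul hnv hmult

/-- **The same for any consumer class set `cmCl K` CONTAINING Liu's classes** (`hcm`, stated on the record's rational formula — no (4.3)
in it; e.g. the package's `cmClasses K μ ⊇` the classes of `d = (A_μ, α)`), by `Submodule.span_mono`.  OVER THE RECORDS; NO `Φ`, `hblock`,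
`J`, `hJ`, `hJinj`, `hpin` binder.  HC_CM is NOT proved; no pin is discharged here.
[cite: Liu2021, Thm. 4.18 (l. 2232–2245) with proof map (4.3) (l. 2247–2266); Prop. 4.13, proof l. 2145; Lem. 2.4 (1) (l. 1210–1213); Def. 4.11] -/
theorem iSup_range_resW_mem_span_of_thm418AsPrinted_of_liuClasses_subset
    [Module (MonoidAlgebra ℂ D.G) M.HB] [IsScalarTower ℂ (MonoidAlgebra ℂ D.G) M.HB]
    (hof : ∀ (g : D.G) (x : M.HB), MonoidAlgebra.of ℂ D.G g • x = M.ρB g x)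
    (h : Liu2021.Thm418AsPrinted D)
    {Lvl : Type*} [Preorder Lvl] (Kof : Lvl → Subgroup D.G)
    (hmono : ∀ ⦃K K' : Lvl⦄, K ≤ K' → Kof K ≤ Kof K') (hoc : ∀ K : Lvl, IsOpenCompact (Kof K))
    (hcof : ∀ K' : Subgroup D.G, IsOpenCompact K' → ∃ K₀ : Lvl, Kof K₀ ≤ K')
    {W : Lvl → Type*} [∀ K, AddCommGroup (W K)] [∀ K, Module ℂ (W K)]
    (resW : ∀ K : Lvl, M.HB →ₗ[ℂ] W K) (cmCl : ∀ K : Lvl, Set (W K))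
    (hcm : ∀ (K : Lvl) (φ : D.HomK (Kof K) M.Dμ), resW K (M.ι ((M.P (D.res (Kof K) M.Dμ φ)).baseChange ℂ M.α)) ∈ cmCl K)
    (hnv : ∀ i : D.AdmIndex, Nontrivial (D.omegaAt i))
    (hmult : ∀ i : D.AdmIndex, Module.rank ℂ ((D.rhoAt i).asModule →ₗ[MonoidAlgebra ℂ D.G] M.HB) ≤ 1) :
    ∃ K₀ : Lvl, ∀ K ≤ K₀,
      ∀ x ∈ (⨆ i : D.AdmIndex, ⨆ ψ : (D.rhoAt i).asModule →ₗ[MonoidAlgebra ℂ D.G] M.HB, (LinearMap.range ψ).restrictScalars ℂ),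
        (∀ k ∈ Kof K, MonoidAlgebra.of ℂ D.G k • x = x) → resW K x ∈ Submodule.span ℂ (cmCl K) := by
  haveI := M.finite_rat_L
  exact Thm418Data.iSup_range_resW_mem_span_of_thm418AsPrinted_of_liuClasses_subset h M.Dμ Kof hmono hoc hcof resW cmCl
    M.rank_L M.P M.P_smul_apply M.P_injective M.ρU M.P_comm M.α M.α_ne M.α_mem M.ι M.ι_injective
    (fun g u => by rw [M.ι_comm, hof]) M.toMap43Data.J M.J_tmul hcm hnv hmult

end Map43RationalData

end Thm418Data

end Literature.NumberTheory.Automorphic.Liu2021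

end
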